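import Summits.QuantumFields.BalabanUV.Beta.FP.TowerK1RowTopCoefficients

/-!
# `BalabanUV.Beta.FP.TowerHLinkRowsLower` — road «FP», binder row D1, ROUTE T (β1): **THE ROAD's LOWER-LEVEL STOREY DATA FOR THE END WRAPPER — the δ-TABLE `cf k`
# AND THE ROOT-BOND EMBEDDING `hb k` OF A SLOT WEIGHT (an2 g61 W-4 (3) ∕ g63 W-3: «`cf k := δ`, `hb k v :=` the slot-periodised weights read as a level-`k` bond vector»),
# WITH THE TWO CONTRACTIONS THE WRAPPER READS (`hH₁f`∕`hlink`'s `Σ_ā hb ā·ĉf(slot)(ā)` and `hlink`'s `Σ_ā hb ā·Σ_slot ĉf(slot)(ā)·symLinKerAt slot`) COMPUTED**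

WHY (`HOME/b2b-balaban-beta-d1-p3/g40/SPEC-51.md` §F∕§G; an2 W-3 l.67480 «ON THE LOWER LEVELS: AGREED»).  Below the finest level the v4 END wrapper
(`FP/StepRecursionFeedNestedNamedC`, p538144) reads its storey data `hb k ∕ cf k` ONLY through the slot weight `λ_k(μ,y) := Σ_ā hb k v ā·ĉf_k(μ,y)(ā)`,
`ĉf_k(μ,y)(ā) := Σ'_m cf k μ (translate (Ma k) y m) ā.2 ā.1` (rows `hH₁f`, `hlink`), and through `hlink`'s left side `Σ_ā hb k v ā·Σ_μ Σ'_y ĉf_k(μ,y)(ā)·symLinKerAt ρ_c Lc μ y a`.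
The cheapest inhabitant: `cf k := δ` (the table `cfδ μ s κ′ x := [x = Lc•s ∧ κ′ = μ]`, whose slot periodisation over the slot torus `S` is the indicator of the ROOT BOND
`(wrapPt T (Lc•y), μ)` of the slot on the bond torus `T = Lc·S`) and `hb k v :=` the root-bond embedding `hbδ Λ` of a slot weight `Λ : Fin 4 → Site 4 → ℝ`
(`hbδ Λ ā := Σ_{y₀ ∈ pbox S} [ā.1 = Lc•y₀]·Λ ā.2 y₀`).  THIS FILE computes, for ANY slot torus `S` with bond torus `T i = Lc·S i` and any `S`-periodic weight `Λ`:
`λ_k = Λ` and `hlink`'s left contraction `= Σ_i Σ'_y Λ i y·symLinKerAt (toSite R.r) Lc i y a` — so that `hlink` becomes an2 PART 18 `periodised_lamR_succ_tower` VERBATIM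
once `Λ := λ̂′ᴿ_k` (road INTENT-3b `FP/TowerHLinkRows`), and `hcf` ∕ `hbl` at the lower levels are immediate.

WHAT ([folklore] finite-sum ∕ `tsum` bookkeeping BY NAME; no `def`, no `def … : Prop`, nothing cited, 0 sorry; everything WRITTEN OUT):
* §1 the δ-table: `smul_translate_eq` (`Lc•(translate S y m) = translate T (Lc•y) m`), **`tsum_cfDelta_translate_eq_ite`** (`ĉfδ(μ,y)(ā) = [ā.2 = μ ∧ ā.1 = wrap T (Lc•y)]`),
  `summable_cfDelta_translate` (the wrapper's `hcf` at the lower levels).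
* §2 the root-bond embedding: `wrap_smul_eq` (`wrap T (Lc•y) = Lc•wrap S y`), `hbDelta_smul_add` (linear in the weight — the wrapper's `hbl`), `hbDelta_apply_root`
  (`hbδ Λ (wrapPt T (Lc•y), μ) = Λ μ (wrap S y)`).
* §4 the wrapper's scalars: `kappa_row` (`hκ`: `κ k = stepScale 3 Lc (n+1−(k+1))·#B·κ (k+1)`), `kappa_top` (`hκn`), `kappa_ne_zero`, **`w_mul_kappa`** (the ladder
  `w k·κ k = w (k+1)·κ (k+1) ∕ (stepScale·Lc⁴)` for `κ k := Π_{k≤i≤n} stepScale (n−i)·#B`, `w k := (−c·(Lc⁴)^{n+2} ∕ Π_{k≤i≤n} stepScale (n−i)·Lc⁴) ∕ κ k`), `w_top`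
  (`w (n+1) = −c·(Lc⁴)^{n+2}` = `TowerK1RowTopColumn.K1_row_top`'s `hw₁`).
* §3 the contractions: **`sum_hbDelta_mul_tsum_cfDelta`** (`Σ_ā hbδ Λ ā·ĉfδ(μ,y)(ā) = Λ μ y` for wrap-blind `Λ`),
  **`sum_hbDelta_mul_sum_tsum_cfDelta_mul_symLinKerAt`** (`Σ_ā hbδ Λ ā·Σ_μ Σ'_y ĉfδ(μ,y)(ā)·symLinKerAt (toSite R.r) Lc μ y a = Σ_μ Σ'_y Λ μ y·symLinKerAt (toSite R.r) Lc μ y a`).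
WHAT THIS IS NOT: not `hlink` (INTENT-3b: these + PART 18 + the scalars `w k·κ k`), not K1, not (J-Λ-fold); no row of the END wrapper discharged here; 0 estimates;
nothing of Bałaban's asserted, valued or discharged; 0∕4 row-D1 binders (hW, hR, D1Tel, D1Rep); ROOT M‴ p325680 ∕ P5c ∕ D6 untouched; NOT (C1), NOT (L2′),
NOT (T-ID), NOT SDF, NOT D1, NEVER «G-an2-4 closed», NOT BetaPertH, NOT continuum, NOT Clay.

HONEST DEPENDENCY (page 1, mandatory): continuum YM on T⁴ ⇐ BetaPertH ∧ nine spine estimates (0/9 proved); BetaPertH ⇐ (D1) ∧ (D4) ∧ CAP+tail;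
G-an2-4 gates asym, D1 and NE2/3/4.  HONEST FRAMING (cell contract, verbatim): «discharging `BetaPertH` makes Bałaban's UV stability UNCONDITIONAL —
a real constructive-QFT result; it is NOT the continuum limit and NOT the Clay problem.»  ABSOLUTE RULE (cell charter, verbatim): «No internally-minted
statement may enter as a cited fact. Every hypothesis is either kernel-proved in this package or a verbatim quotation of a PUBLISHED theorem with page
reference. The manuscript(s) under audit are NOT citable for their own disputed steps — they are the thing under adjudication; programme-internal
(2001/route/tribunal) claims are never citable.»  Road «FP» OWNER, b2b-balaban-beta-d1-p3 gen 41, 2026-08-27.  No existing file touched.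
-/

noncomputable section

open scoped BigOperators

namespace Summit.QuantumFields.BalabanUV.Beta.FP.TowerHLinkRowsLower

open Finset
open Literature.MathematicalPhysics.QuantumFieldTheory
open Literature.MathematicalPhysics.QuantumFieldTheory.Balaban1983to89
open Literature.MathematicalPhysics.QuantumFieldTheory.Balaban1983to89.Beta
open B4TorusKernel.MultiPeriod (translate translate_apply translate_injective)
open B6Lemma24Torus (pbox wrap wrap_mem_pbox wrap_eq_self)
open AffineAveraging (Site box toSite)
open AveragingHessianKernels (Bond)
open Summit.QuantumFields.BalabanUV.Beta.AxialDressingRooted (one_le_of_neZero)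
open AveragingContoursRooted (ctrOff ctrOff_mem_box)
open Summit.QuantumFields.BalabanUV.Beta.CompositeOneShotJetData (Roots)
open Summit.QuantumFields.BalabanUV.Beta.BorderedHessian (stepScale stepScale_ne_zero)
open Summit.QuantumFields.BalabanUV.Beta.SymAveragingHessianCounts (symLinKerAt symLinKerAt_eq_zero)
open Summit.QuantumFields.BalabanUV.Beta.FP.TorusGaugeCovariancePairing (wrapPt wrapPt_coe wrapPt_of_mem)
open Summit.QuantumFields.BalabanUV.Beta.GAN24.KernelPeriodisation (quo translate_wrap_quo wrap_translate)
open Summit.QuantumFields.BalabanUV.Beta.CoclosedCovectorLinearRowsNear (summable_of_near)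

variable {Lc : ℕ} [NeZero Lc] (R : Roots Lc) (S T : Fin (3 + 1) → ℕ) [∀ i, NeZero (S i)] [∀ i, NeZero (T i)] (hTS : ∀ i, T i = Lc * S i)

/-! ## §1 The δ-table and its slot periodisation -/

section Delta

omit [NeZero Lc] [∀ i, NeZero (S i)] [∀ i, NeZero (T i)] in
include hTS in
/-- [folklore] scaling a slot translate is a bond translate: `Lc•(translate S y m) = translate T (Lc•y) m` (`T = Lc·S`). -/
theorem smul_translate_eq (y m : Site (3 + 1)) : (Lc : ℤ) • translate S y m = translate T ((Lc : ℤ) • y) m := by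
  funext i
  simp only [Pi.smul_apply, smul_eq_mul, translate_apply, hTS i, Nat.cast_mul]
  ring

omit [NeZero Lc] [∀ i, NeZero (S i)] [∀ i, NeZero (T i)] in
/-- [folklore] `wrap` is blind to period translates (any base point). -/
theorem wrap_translate_any (z m : Site (3 + 1)) : wrap T (translate T z m) = wrap T z := by
  funext i
  simp only [wrap, translate_apply]
  exact Int.add_mul_emod_self_left _ _ _

omit [NeZero Lc] [∀ i, NeZero (S i)] in
/-- [folklore] a box point equals a translate of `z` iff it is `wrap T z`, and then the translate index is `−quo T z`. -/
theorem coe_eq_translate_iff {p : ↥(pbox T)} (z m : Site (3 + 1)) :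
    (p : Site (3 + 1)) = translate T z m ↔ (p : Site (3 + 1)) = wrap T z ∧ m = -quo T z := by
  constructor
  · intro h
    have hw : (p : Site (3 + 1)) = wrap T z := by rw [← wrap_eq_self p.2, h, wrap_translate_any]
    refine ⟨hw, ?_⟩
    have h2 : translate T z m = translate T z (-quo T z) := by
      rw [← h, hw]
      funext i
      have := congrFun (translate_wrap_quo T z) i
      simp only [translate_apply] at this ⊢
      simp only [Pi.neg_apply]
      linarith
    exact translate_injective (fun i => one_le_of_neZero (T i)) z h2
  · rintro ⟨hp, rfl⟩
    rw [hp]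
    funext i
    have := congrFun (translate_wrap_quo T z) i
    simp only [translate_apply] at this ⊢
    simp only [Pi.neg_apply]
    linarith

omit [NeZero Lc] [∀ i, NeZero (S i)] in
include hTS in
/-- [folklore] **`tsum_cfDelta_translate_eq_ite` — THE SLOT PERIODISATION OF THE δ-TABLE IS THE INDICATOR OF THE SLOT's ROOT BOND**:
`Σ'_m [ā.1 = Lc•(translate S y m) ∧ ā.2 = μ] = [ā.2 = μ ∧ ā.1 = wrap T (Lc•y)]`. -/
theorem tsum_cfDelta_translate_eq_ite (μ : Fin (3 + 1)) (y : Site (3 + 1)) (ā : ↥(pbox T) × Fin (3 + 1)) :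
    (∑' m : Site (3 + 1), (if (ā.1 : Site (3 + 1)) = (Lc : ℤ) • translate S y m ∧ ā.2 = μ then (1 : ℝ) else 0))
      = if ā.2 = μ ∧ (ā.1 : Site (3 + 1)) = wrap T ((Lc : ℤ) • y) then 1 else 0 := by
  simp_rw [smul_translate_eq S T hTS]
  by_cases h : ā.2 = μ ∧ (ā.1 : Site (3 + 1)) = wrap T ((Lc : ℤ) • y)
  · rw [if_pos h, tsum_eq_single (-quo T ((Lc : ℤ) • y))]
    · rw [if_pos ⟨((coe_eq_translate_iff T _ _).2 ⟨h.2, rfl⟩), h.1⟩]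
    · intro m hm
      rw [if_neg]
      rintro ⟨h1, -⟩
      exact hm ((coe_eq_translate_iff T _ _).1 h1).2
  · rw [if_neg h]
    refine (tsum_congr fun m => ?_).trans tsum_zero
    rw [if_neg]
    rintro ⟨h1, h2⟩
    exact h ⟨h2, ((coe_eq_translate_iff T _ _).1 h1).1⟩

omit [NeZero Lc] [∀ i, NeZero (S i)] in
include hTS in
/-- [folklore] **the wrapper's `hcf` at the lower levels**: the δ-table's slot periodisation has at most one non-zero term (summable), for EVERY site `x`. -/
theorem summable_cfDelta_translate (μ κ' : Fin (3 + 1)) (y x : Site (3 + 1)) :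
    Summable fun m : Site (3 + 1) => (if x = (Lc : ℤ) • translate S y m ∧ κ' = μ then (1 : ℝ) else 0) := by
  refine summable_of_ne_finset_zero (s := {fun i => (x i - ((Lc : ℤ) • y) i) / (T i : ℤ)}) fun m hm => ?_
  rw [Finset.mem_singleton] at hm
  rw [if_neg]
  rintro ⟨h1, -⟩
  rw [smul_translate_eq S T hTS] at h1
  apply hm
  funext i
  have hi := congrFun h1 i
  simp only [translate_apply] at hi
  have hT0 : (T i : ℤ) ≠ 0 := by exact_mod_cast NeZero.ne (T i)
  rw [hi, add_sub_cancel_left, Int.mul_ediv_cancel_left _ hT0]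

end Delta

/-! ## §2 The root-bond embedding of a slot weight -/

section RootBond

omit [∀ i, NeZero (S i)] [∀ i, NeZero (T i)] in
include hTS in
/-- [folklore] `wrap T (Lc•y) = Lc•wrap S y` (`T = Lc·S`; `Int.mul_emod_mul_of_pos`). -/
theorem wrap_smul_eq (y : Site (3 + 1)) : wrap T ((Lc : ℤ) • y) = (Lc : ℤ) • wrap S y := by
  have hL : (0 : ℤ) < (Lc : ℤ) := by exact_mod_cast Nat.pos_of_ne_zero (NeZero.ne Lc)
  funext i
  simp only [wrap, Pi.smul_apply, smul_eq_mul, hTS i, Nat.cast_mul]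
  exact Int.mul_emod_mul_of_pos _ _ hL

omit [∀ i, NeZero (S i)] [∀ i, NeZero (T i)] in
/-- [folklore] `Lc•` is injective on sites. -/
theorem smul_site_injective {y y' : Site (3 + 1)} (h : (Lc : ℤ) • y = (Lc : ℤ) • y') : y = y' := by
  have hL : (Lc : ℤ) ≠ 0 := by exact_mod_cast NeZero.ne Lc
  funext i
  have hi := congrFun h i
  simp only [Pi.smul_apply, smul_eq_mul] at hi
  exact mul_left_cancel₀ hL hi

omit [NeZero Lc] [∀ i, NeZero (S i)] [∀ i, NeZero (T i)] in
/-- [folklore] **the root-bond embedding is linear in the weight** (the wrapper's `hbl` at the lower levels, once the weight is linear in the source). -/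
theorem hbDelta_smul_add (r : ℝ) (Λ Λ' : Fin (3 + 1) → Site (3 + 1) → ℝ) (ā : ↥(pbox T) × Fin (3 + 1)) :
    (∑ y₀ : ↥(pbox S), (if (ā.1 : Site (3 + 1)) = (Lc : ℤ) • (y₀ : Site (3 + 1)) then (r * Λ ā.2 y₀ + Λ' ā.2 y₀) else 0))
      = r * (∑ y₀ : ↥(pbox S), (if (ā.1 : Site (3 + 1)) = (Lc : ℤ) • (y₀ : Site (3 + 1)) then Λ ā.2 y₀ else 0))
        + ∑ y₀ : ↥(pbox S), (if (ā.1 : Site (3 + 1)) = (Lc : ℤ) • (y₀ : Site (3 + 1)) then Λ' ā.2 y₀ else 0) := by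
  rw [Finset.mul_sum, ← Finset.sum_add_distrib]
  refine Finset.sum_congr rfl fun y₀ _ => ?_
  split_ifs <;> ring

omit [∀ i, NeZero (T i)] in
include hTS in
/-- [folklore] **`hbDelta_apply_root` — AT THE ROOT BOND OF A SLOT THE EMBEDDING READS THE WEIGHT**: `hbδ Λ (wrapPt T (Lc•y), μ) = Λ μ (wrap S y)`. -/
theorem hbDelta_apply_root (Λ : Fin (3 + 1) → Site (3 + 1) → ℝ) (μ : Fin (3 + 1)) (y : Site (3 + 1)) (p : ↥(pbox T))
    (hp : (p : Site (3 + 1)) = wrap T ((Lc : ℤ) • y)) :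
    (∑ y₀ : ↥(pbox S), (if ((p, μ) : ↥(pbox T) × Fin (3 + 1)).1 = ((Lc : ℤ) • (y₀ : Site (3 + 1)) : Site (3 + 1)) then Λ ((p, μ) : ↥(pbox T) × Fin (3 + 1)).2 y₀ else 0))
      = Λ μ (wrap S y) := by
  rw [Finset.sum_eq_single (wrapPt S y)]
  · rw [if_pos]
    · rw [wrapPt_coe]
    · show (p : Site (3 + 1)) = (Lc : ℤ) • (wrapPt S y : Site (3 + 1))
      rw [hp, wrapPt_coe, wrap_smul_eq S T hTS]
  · intro y₀ _ hy₀
    rw [if_neg]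
    intro h
    apply hy₀
    apply Subtype.ext
    have h' : (Lc : ℤ) • (y₀ : Site (3 + 1)) = (Lc : ℤ) • wrap S y := by
      rw [← wrap_smul_eq S T hTS, ← hp]
      exact h.symm
    rw [wrapPt_coe]
    exact smul_site_injective h'
  · intro h; exact absurd (Finset.mem_univ _) h

end RootBond

/-! ## §3 The two contractions the wrapper reads -/

section Contractions

include hTS in
/-- [folklore] **`sum_hbDelta_mul_tsum_cfDelta` — THE SLOT WEIGHT IS RECOVERED**: for a wrap-blind weight `Λ` (`Λ μ (wrap S y) = Λ μ y`), every slot `(μ, y)`: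
`Σ_ā hbδ Λ ā·ĉfδ(μ,y)(ā) = Λ μ y` — the wrapper's contraction `Σ_ā hb k v ā·Σ'_m cf k μ (translate (Ma k) y m) ā.2 ā.1` at `cf k := δ`, `hb k v := hbδ (λ_k v)`. -/
theorem sum_hbDelta_mul_tsum_cfDelta (Λ : Fin (3 + 1) → Site (3 + 1) → ℝ) (hΛ : ∀ μ y, Λ μ (wrap S y) = Λ μ y)
    (μ : Fin (3 + 1)) (y : Site (3 + 1)) :
    ∑ ā : ↥(pbox T) × Fin (3 + 1),
        (∑ y₀ : ↥(pbox S), (if (ā.1 : Site (3 + 1)) = (Lc : ℤ) • (y₀ : Site (3 + 1)) then Λ ā.2 y₀ else 0))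
          * (∑' m : Site (3 + 1), (if (ā.1 : Site (3 + 1)) = (Lc : ℤ) • translate S y m ∧ ā.2 = μ then (1 : ℝ) else 0))
      = Λ μ y := by
  simp_rw [tsum_cfDelta_translate_eq_ite S T hTS]
  rw [Finset.sum_eq_single ((wrapPt T ((Lc : ℤ) • y), μ) : ↥(pbox T) × Fin (3 + 1))]
  · rw [if_pos ⟨rfl, wrapPt_coe T _⟩, mul_one, hbDelta_apply_root S T hTS Λ μ y _ (wrapPt_coe T _), hΛ]
  · intro ā _ hā
    rw [if_neg, mul_zero]
    rintro ⟨h2, h1⟩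
    apply hā
    refine Prod.ext (Subtype.ext ?_) h2
    rw [h1, wrapPt_coe]
  · intro h; exact absurd (Finset.mem_univ _) h

include hTS in
/-- [folklore] **`sum_hbDelta_mul_sum_tsum_cfDelta_mul_symLinKerAt` — `hlink`'s LEFT CONTRACTION AT THE LOWER DATA IS THE WEIGHT AGAINST THE BRICK ROW**: for a wrap-blind
weight `Λ` and every bond `u` of the bond torus,
`Σ_ā hbδ Λ ā·Σ_μ Σ'_y ĉfδ(μ,y)(ā)·symLinKerAt (toSite R.r) Lc μ y (u.2, u.1) = Σ_μ Σ'_y Λ μ y·symLinKerAt (toSite R.r) Lc μ y (u.2, u.1)`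
(the finite `Σ_ā` moves inside by `TowerK1RowTopCoefficients.sum_mul_sum_tsum_mul_symLinKerAt_comm`, then the slot contraction above). -/
theorem sum_hbDelta_mul_sum_tsum_cfDelta_mul_symLinKerAt (Λ : Fin (3 + 1) → Site (3 + 1) → ℝ) (hΛ : ∀ μ y, Λ μ (wrap S y) = Λ μ y)
    (u : ↥(pbox T) × Fin (3 + 1)) :
    ∑ ā : ↥(pbox T) × Fin (3 + 1),
        (∑ y₀ : ↥(pbox S), (if (ā.1 : Site (3 + 1)) = (Lc : ℤ) • (y₀ : Site (3 + 1)) then Λ ā.2 y₀ else 0))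
          * ∑ μ : Fin (3 + 1), ∑' y : Site (3 + 1),
              (∑' m : Site (3 + 1), (if (ā.1 : Site (3 + 1)) = (Lc : ℤ) • translate S y m ∧ ā.2 = μ then (1 : ℝ) else 0))
                * symLinKerAt (toSite R.r) Lc μ y (u.2, (u.1 : Site (3 + 1)))
      = ∑ μ : Fin (3 + 1), ∑' y : Site (3 + 1), Λ μ y * symLinKerAt (toSite R.r) Lc μ y (u.2, (u.1 : Site (3 + 1))) := by
  rw [TowerK1RowTopCoefficients.sum_mul_sum_tsum_mul_symLinKerAt_comm R T _
    (fun μ y ā => ∑' m : Site (3 + 1), (if (ā.1 : Site (3 + 1)) = (Lc : ℤ) • translate S y m ∧ ā.2 = μ then (1 : ℝ) else 0)) u]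
  refine Finset.sum_congr rfl fun μ _ => tsum_congr fun y => ?_
  rw [sum_hbDelta_mul_tsum_cfDelta S T hTS Λ hΛ μ y]

end Contractions

/-! ## §4 The END wrapper's scalars `κ k`, `w k` (rows `hκ`, `hκn`; the ladder identity behind `hlink`) -/

section Scalars

variable (n : ℕ) (c : ℝ)

omit [NeZero Lc] in
/-- [folklore] **`hκ`**: `κ k = stepScale 3 Lc (n+1−(k+1))·#B·κ (k+1)` for `k < n+1` (peel the bottom factor of the product). -/
theorem kappa_row (κF : ℕ → ℝ)
    (hκF : ∀ k, κF k = ∏ i ∈ Finset.Ico k (n + 1), (stepScale 3 Lc (n + 1 - (i + 1)) * ((box (3 + 1) Lc).card : ℝ)))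
    (k : ℕ) (hk : k < n + 1) :
    κF k = stepScale 3 Lc (n + 1 - (k + 1)) * ((box (3 + 1) Lc).card : ℝ) * κF (k + 1) := by
  rw [hκF k, hκF (k + 1), Finset.prod_eq_prod_Ico_succ_bot hk]

omit [NeZero Lc] in
/-- [folklore] **`hκn`**: `κ (n+1) = 1` (empty product). -/
theorem kappa_top (κF : ℕ → ℝ)
    (hκF : ∀ k, κF k = ∏ i ∈ Finset.Ico k (n + 1), (stepScale 3 Lc (n + 1 - (i + 1)) * ((box (3 + 1) Lc).card : ℝ))) :
    κF (n + 1) = 1 := by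
  rw [hκF, Finset.Ico_self, Finset.prod_empty]

/-- [folklore] `κ k ≠ 0` (`stepScale ≠ 0`, the block is non-empty). -/
theorem kappa_ne_zero (κF : ℕ → ℝ)
    (hκF : ∀ k, κF k = ∏ i ∈ Finset.Ico k (n + 1), (stepScale 3 Lc (n + 1 - (i + 1)) * ((box (3 + 1) Lc).card : ℝ))) (k : ℕ) :
    κF k ≠ 0 := by
  rw [hκF k]
  refine Finset.prod_ne_zero_iff.2 fun i _ => mul_ne_zero (stepScale_ne_zero _) ?_
  have h : (box (3 + 1) Lc).Nonempty := ⟨ctrOff (3 + 1) Lc, ctrOff_mem_box (one_le_of_neZero Lc)⟩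
  exact_mod_cast (Finset.card_pos.2 h).ne'

/-- [folklore] **THE SCALAR LADDER**: with `w k := (−c·(Lc⁴)^{n+2} ∕ Π_{k≤i≤n} stepScale (n−i)·Lc⁴) ∕ κ k`,
`w k·κ k = w (k+1)·κ (k+1) ∕ (stepScale 3 Lc (n+1−(k+1))·Lc⁴)` for `k < n+1`. -/
theorem w_mul_kappa (κF wF : ℕ → ℝ)
    (hκF : ∀ k, κF k = ∏ i ∈ Finset.Ico k (n + 1), (stepScale 3 Lc (n + 1 - (i + 1)) * ((box (3 + 1) Lc).card : ℝ)))
    (hwF : ∀ k, wF k = (-(c * ((Lc : ℝ) ^ (3 + 1)) ^ (n + 1 + 1))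
        / ∏ i ∈ Finset.Ico k (n + 1), (stepScale 3 Lc (n + 1 - (i + 1)) * (Lc : ℝ) ^ (3 + 1))) / κF k)
    (k : ℕ) (hk : k < n + 1) :
    wF k * κF k = wF (k + 1) * κF (k + 1) / (stepScale 3 Lc (n + 1 - (k + 1)) * (Lc : ℝ) ^ (3 + 1)) := by
  have hLc : (Lc : ℝ) ≠ 0 := Nat.cast_ne_zero.mpr (NeZero.ne Lc)
  have hκk := kappa_ne_zero n κF hκF k
  have hκk1 := kappa_ne_zero n κF hκF (k + 1)
  have hσ : stepScale 3 Lc (n + 1 - (k + 1)) * (Lc : ℝ) ^ (3 + 1) ≠ 0 := mul_ne_zero (stepScale_ne_zero _) (pow_ne_zero _ hLc)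
  have hP : ∏ i ∈ Finset.Ico (k + 1) (n + 1), (stepScale 3 Lc (n + 1 - (i + 1)) * (Lc : ℝ) ^ (3 + 1)) ≠ 0 :=
    Finset.prod_ne_zero_iff.2 fun i _ => mul_ne_zero (stepScale_ne_zero _) (pow_ne_zero _ hLc)
  rw [hwF k, hwF (k + 1), Finset.prod_eq_prod_Ico_succ_bot hk, div_mul_cancel₀ _ hκk, div_mul_cancel₀ _ hκk1]
  field_simp

omit [NeZero Lc] in
/-- [folklore] **at the top** `w (n+1) = −c·((Lc:ℝ)^(3+1))^(n+1+1)` (= `TowerK1RowTopColumn.K1_row_top`'s `hw₁`). -/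
theorem w_top (κF wF : ℕ → ℝ)
    (hκF : ∀ k, κF k = ∏ i ∈ Finset.Ico k (n + 1), (stepScale 3 Lc (n + 1 - (i + 1)) * ((box (3 + 1) Lc).card : ℝ)))
    (hwF : ∀ k, wF k = (-(c * ((Lc : ℝ) ^ (3 + 1)) ^ (n + 1 + 1))
        / ∏ i ∈ Finset.Ico k (n + 1), (stepScale 3 Lc (n + 1 - (i + 1)) * (Lc : ℝ) ^ (3 + 1))) / κF k) :
    wF (n + 1) = -(c * ((Lc : ℝ) ^ (3 + 1)) ^ (n + 1 + 1)) := by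
  rw [hwF, kappa_top n κF hκF, Finset.Ico_self, Finset.prod_empty, div_one, div_one]

end Scalars

end Summit.QuantumFields.BalabanUV.Beta.FP.TowerHLinkRowsLower

end
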